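import Summits.CriticalPhenomena.PercolationContinuityZ3.Theses.PercPortalLadder
import Literature.Probability.Percolation.PercolationProofs
import Literature.Probability.Percolation.CriticalContinuityProofs

/-!
# Birth skeleton (BC3) for the crux `GridWallPersistence` (stmt-CriticalPhenomena-14517)

Route `route-CriticalPhenomena-PercPortalLadder` (sub-problem `PercolationContinuityZ3`), crux decl
`Summit.CriticalPhenomena.PercolationContinuityZ3.Theses.PercPortalLadder.GridWallPersistence` (rank 6, the
same-`p` bridge of the portal ladder): **if `θ_{ℤ³}(0, p_c) > 0` then for EVERY spacing `k ≥ 1` some vertex of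
the RIVETED GRAPH `G_{Π_k} := ℤ³` minus the crossing edges `s(x, x − e₀)`, `x₀ = 0`, `x ∉ Π_k = {k ∣ x₁, k ∣ x₂}`
percolates at `p_c(ℤ³)`** — sealing one lattice plane except a periodic rivet grid cannot destroy a critical
infinite cluster. Conjunct-adjacent and declared so (vacuous iff `θ_{ℤ³}(p_c) = 0`); trivially true at every
`p > p_c` (`G_{Π_k} ⊇ H⁺`, `p_c(H⁺) = p_c`); at `p = p_c` it is the dilution-side twin of the defect-plane
question at bulk criticality left open in print (Iliev–Janse van Rensburg–Madras 2014 p. 5; Newman–Wu 1997).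
With `gridGraph k := (zdGraph 3).deleteEdges (gridWall k)` the crux is LITERALLY
`0 < θ_{ℤ³}(0,p_c) → ∀ k ≥ 1, ∃ v, 0 < θ_{gridGraph k}(v, p_c)` (`gridWallPersistence_iff`, `Iff.rfl`).

THE LINE — "TRANSFER TO THE SUPERCRITICAL PHASE AND COME DOWN FROM THE RIGHT". The crux lives ON the
critical line, where no tool controls a perforated plane (Aizenman–Grimmett is void: `p_c(G_{Π_k}) = p_c`;
sprinkling renormalisation shifts `p`; mass transport is blind). But `θ` is continuous FROM THE RIGHT on `[0,1]`
for every locally finite graph (Grimmett 1999 Lemma (8.9), Russo 1978: `θ` is the decreasing limit of the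
polynomials `P_p(v ↔ ∂B(v,n))`, hence upper semicontinuous, and it is non-decreasing), so
`θ_{G_{Π_k}}(v, p_c) = lim_{p ↓ p_c} θ_{G_{Π_k}}(v, p)`, while `θ_{ℤ³}(0, p) ≥ θ_{ℤ³}(0, p_c)` for `p > p_c`.
Hence the crux follows from any comparison of the two SUPERCRITICAL order parameters that is uniform as
`p ↓ p_c` — and the weakest natural one is POLYNOMIAL DOMINATION at the rivet vertex `0 ∈ Π_k`:
`θ_{G_{Π_k}}(0, p) ≥ c_k · θ_{ℤ³}(0, p)^{m_k}` for all `p ∈ (p_c, 1]`. Two registered stubs: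

* STUB 1 `stub_supercriticalPolyDomination` (XL, OPEN — LOAD-BEARING): **for every `k ≥ 1` there are `m : ℕ`
  and `c > 0` with `c · θ_{ℤ³}(0, p)^m ≤ θ_{G_{Π_k}}(0, p)` for every `p ∈ (p_c(ℤ³), 1]`** — the riveted graph's
  order parameter at the rivet has NO ESSENTIAL SINGULARITY relative to the bulk one ("the cut heals at a
  polynomial rate"). It is a statement about the SUPERCRITICAL phase only (`p > p_c` strict), where both graphs
  percolate (`G_{Π_k} ⊇ H⁺`, `θ_{H⁺}(p) > 0` for `p > p_c`: Barsky–Grimmett–Newman 1991, in tree as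
  `criticalProb_halfSpace_eq` / `theta_halfSpace_pos_of_criticalProb_lt`) and uniqueness, Grimmett–Marstrand
  slabs and static renormalisation are all available at each fixed `p`; the content is the UNIFORMITY of the
  constants as `p ↓ p_c`, measured against `θ_{ℤ³}(0,p)` itself rather than against `p − p_c`. It is NOT vacuous
  in the continuous world `θ(p_c) = 0`: there it is the scaling statement `β_defect(k) ≤ m·β`, predicted with
  room to spare already by the trivial bound `θ_{G_{Π_k}}(0,p) ≥ θ_{H⁺}(0,p) ∼ (p − p_c)^{β₁}`,
  `β₁/β = x_{h1}/x_h ≈ 0.975/0.477 ≈ 2.04 < 3` (ordinary-surface and bulk magnetic dimensions of 3D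
  percolation, Deng–Blöte 2005), and with `m = 1` if the rivet sheet is RG-relevant at the cut
  (eigenvalue `(d−1) − 2x_{h1} ≈ +0.05`, Cardy 1996 §7.2 — the route header's own count). In a discontinuous
  world `θ(p_c) > 0` it is EQUIVALENT to the crux at spacing `k` (⇒ by STUB 2 below; ⇐ with `c = θ_{G_{Π_k}}(0,p_c)`,
  `m = 0`, monotonicity of `θ` in `p` and finite energy to move the percolating vertex to `0`) — an honest
  piece, not a cheap one (BC3 probes below). `k = 1` is trivial (`gridWall 1 = ∅`-in-effect, `m = 1`, `c = 1`).
  Why it might fail: the marginal case `x_{h1} = 1` (eigenvalue `0`, inside the error bars of `+0.05`) allows a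
  Kosterlitz–Thouless-type essential crossover `θ_{G_{Π_k}}(0,p) ≈ exp(−a (p−p_c)^{−b})·…` near the wall, which no
  power of `θ_{ℤ³}(0,p) ≥ c(p − p_c)` (Aizenman–Barsky / Chayes–Chayes mean-field bound) dominates; and in the
  `θ(p_c) > 0` world it IS the defect transition at bulk criticality that nothing in print excludes. Rigorously
  not even the half-space profile bound `θ_{H⁺}(0,p) ≥ c θ(p)^m` is known (FKG only gives
  `θ_{H⁺}(0,p) ≥ p^n θ_{H⁺}(ne₀,p)` with `n ∼ ξ(p)`, an essential-singularity lower bound) — and that half-space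
  version must NOT be used: it implies `θ(p_c) = 0` outright (with BGN `θ_{H⁺}(p_c) = 0` and STUB 2), i.e. it is
  the conjunct in costume; the rivets (both half-spaces) are essential to STUB 1.
* STUB 2 `stub_rightUpperSemicontinuity` (M, PROVABLE NOW): **right upper semicontinuity of `θ` for every
  edge-deleted sublattice of `ℤ³`** — for `E ⊆ Sym2 ℤ³`, `v`, `p₀ < 1` and `c`: if `c ≤ θ_{ℤ³∖E}(v, p)` for all
  `p ∈ (p₀, 1]` then `c ≤ θ_{ℤ³∖E}(v, p₀)` (Grimmett 1999 Lemma (8.9), p. 203; Russo 1978). Proof sketch with tree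
  anchors: `θ ≤ θ_n := P_p(v ↔ ∂B(v,n))` (`DCTQ.thetaN`, `percolatesAt ⊆ armEvent` a.s.), `θ_n` continuous in `p`
  (`DCTQ.continuous_thetaN`, a cylinder polynomial `Russo.cylPoly`), so `c ≤ θ_n(p₀)` by letting `p ↓ p₀`
  (`p₀ < 1`: such `p` exist), and `c ≤ θ` by `DCTQ.le_theta_of_forall_le_real_armEvent` (`n → ∞`); the instance
  `((zdGraph 3).deleteEdges E).LocallyFinite` comes from `zdGraph 3` (degree ≤ 6). No such statement for `θ`
  is in the tree (only `upperSemicontinuous_real_openConn` for `τ`, ConnectivityContinuityProofs.lean).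

Composition (kernel-checked, no `sorry`): `GridWallPersistence_of : stub_supercriticalPolyDomination →
stub_rightUpperSemicontinuity → GridWallPersistence` (hypotheses typed by the name-keyed aliases
`__Registered.stub_*`): given `θ_{ℤ³}(0,p_c) > 0` and `k ≥ 1`, STUB 1 gives `m, c`; put
`a := c · θ_{ℤ³}(0,p_c)^m > 0`; for `p > p_c`, `a ≤ c · θ_{ℤ³}(0,p)^m ≤ θ_{G_{Π_k}}(0,p)` by monotonicity of
`θ_{ℤ³}` in `p` (`theta_mono_holds`, in tree); STUB 2 at `p₀ = p_c < 1`
(`Grimmett1999_criticalProb_pos_lt_one_holds`, in tree) gives `a ≤ θ_{G_{Π_k}}(0, p_c)`, so `v = 0` percolates.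

BC3 (planner probes, 2026-08-17, `bc/GridWallPersistence_bc3_probes.lean`, stub statements re-declared WITHOUT
the sorried theorems or the composition in scope): `stub₁ → GridWallPersistence`, `stub₁ → PercolationContinuityZ3`,
`stub₂ → GridWallPersistence`, `stub₂ → PercolationContinuityZ3`, each by
`first | exact? | simpa [stub] | (unfold stub; simpa) | aesop` at 400k heartbeats: all must FAIL (results in
`Lines/birth.md`). STUB 1 is silent AT `p_c` (strict `p_c < p`), so it cannot give the crux without a passage
to the limit; STUB 2 is a regularity statement true on every graph.

DISPROOF USED: none exists for this crux (`ledger crux ls stmt-CriticalPhenomena-14517`: no workfiles, no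
`Disproof.lean`, no landed Negative lemma, 2026-08-17). Negatives index (11 refuted statements of the summit):
none concerns riveted/perforated planes, supercritical comparison inequalities or semicontinuity of `θ`.
Refuter crux-attacks (2026-08-16, gen 0 and gen 2) SURVIVED and classified the crux as
`GridWallPersistence ↔ (PortalGridRung → PercolationContinuityZ3)`; the k = 1 instance is provable from the
hypothesis — consistent with STUB 1 at `k = 1` being trivial.

NOT REGISTERED (foreseen layer below STUB 1, provers' `--supports` lemmas, D-0019 two-layer cap): finite energy at
the rivet (`θ_{G_{Π_k}}(0,p) ≥ p^{|γ|} θ_{G_{Π_k}}(v,p)`), uniqueness of the infinite cluster of `G_{Π_k}` for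
`p > p_c`, and the supercritical two-sided gluing estimate through the rivet grid with constants polynomial in
`θ_{ℤ³}(0,p)` — the creative content of STUB 1, deliberately not frozen here.
-/

noncomputable section

namespace Summit.CriticalPhenomena.PercolationContinuityZ3.Cruxes.GridWallPersistence.Birth

open MeasureTheory Literature.Probability.Percolation Literature.Probability.LatticeModels
open Summit.CriticalPhenomena.PercolationContinuityZ3.Theses.PercPortalLadder (GridWallPersistence)

/-! ## Objects of the line -/

/-- The SEALED WALL of spacing `k`: the crossing ("portal") edges `s(x, x − e₀)`, `x₀ = 0`, that are
NOT above the rivet grid `Π_k = {x₀ = 0, k ∣ x₁, k ∣ x₂}` (verbatim the edge set deleted in the crux). -/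
def gridWall (k : ℕ) : Set (Sym2 (Site 3)) :=
  {e | ∃ x : Site 3, x 0 = 0 ∧ x ∉ {y : Site 3 | (k : ℤ) ∣ y 1 ∧ (k : ℤ) ∣ y 2} ∧
    e = s(x, x - Pi.single 0 1)}

/-- The RIVETED GRAPH `G_{Π_k}`: `ℤ³` minus the sealed wall — the two half-spaces `H⁺ = {x₀ ≥ 0}`,
`H⁻ = {x₀ ≤ −1}` glued only through the rivets above `Π_k`. The origin `0` is the top of a rivet for
every `k` (`k ∣ 0`). -/
def gridGraph (k : ℕ) : SimpleGraph (Site 3) := (zdGraph 3).deleteEdges (gridWall k)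

/-- The crux is literally `0 < θ_{ℤ³}(0, p_c) → ∀ k ≥ 1, ∃ v, 0 < θ_{G_{Π_k}}(v, p_c(ℤ³))`. -/
theorem gridWallPersistence_iff :
    GridWallPersistence ↔
      (0 < theta (zdGraph 3) 0 (criticalProbI 3) →
        ∀ k : ℕ, 1 ≤ k → ∃ v : Site 3, 0 < theta (gridGraph k) v (criticalProbI 3)) :=
  Iff.rfl

/-! ## The two stub statements -/

/-- STUB 1 statement: POLYNOMIAL DOMINATION IN THE SUPERCRITICAL PHASE — for every spacing `k ≥ 1`
there are `m : ℕ` and `c > 0` with `c · θ_{ℤ³}(0, p)^m ≤ θ_{G_{Π_k}}(0, p)` for all `p ∈ (p_c(ℤ³), 1]`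
(the order parameter of the riveted graph at the rivet vertex `0` has no essential singularity relative to
the bulk one as `p ↓ p_c`). Strictly supercritical: silent at `p = p_c`. -/
def SupercriticalPolyDomination : Prop :=
  ∀ k : ℕ, 1 ≤ k → ∃ m : ℕ, ∃ c : ℝ, 0 < c ∧
    ∀ p : unitInterval, (criticalProbI 3 : ℝ) < p →
      c * theta (zdGraph 3) 0 p ^ m ≤ theta (gridGraph k) 0 p

/-- STUB 2 statement: RIGHT UPPER SEMICONTINUITY of `θ` for every edge-deleted sublattice `ℤ³ ∖ E`
(Grimmett 1999 Lemma (8.9): `θ` is continuous from the right on `[0, 1]`), in the one-sided-bound form: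
a lower bound valid on `(p₀, 1]` persists at `p₀` (for `p₀ < 1`). -/
def RightUpperSemicontinuity : Prop :=
  ∀ (E : Set (Sym2 (Site 3))) (v : Site 3) (p₀ : unitInterval), (p₀ : ℝ) < 1 →
    ∀ c : ℝ, (∀ p : unitInterval, (p₀ : ℝ) < p → c ≤ theta ((zdGraph 3).deleteEdges E) v p) →
      c ≤ theta ((zdGraph 3).deleteEdges E) v p₀

/-! ## Registered stubs -/

/-- **STUB 1 `supercriticalPolyDomination`** (XL, OPEN — LOAD-BEARING): `∀ k ≥ 1, ∃ m c, 0 < c ∧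
∀ p > p_c, c · θ_{ℤ³}(0,p)^m ≤ θ_{G_{Π_k}}(0,p)`. Engine (none complete): supercritical tools at each fixed
`p > p_c` (uniqueness, Grimmett–Marstrand slabs, static renormalisation, finite energy at the rivets) run with
constants tracked POLYNOMIALLY in `θ_{ℤ³}(0,p)` rather than in `p − p_c`; heuristically `m = 1` if the rivet
sheet is RG-relevant at the cut (eigenvalue `(d−1) − 2x_{h1} ≈ +0.05`, Cardy 1996 §7.2 with Deng–Blöte 2005
`x_{h1} ≈ 0.975`), and `m = 3 > β₁/β ≈ 2.04` suffices already from `G_{Π_k} ⊇ H⁺` in the ordinary-surface scaling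
picture. Why it might fail: marginal `x_{h1} = 1` ⇒ essential (KT-type) crossover singularity beating every power
of `θ_{ℤ³}(0,p) ≥ c (p − p_c)`; in a `θ(p_c) > 0` world it is the defect transition at bulk criticality itself
(Iliev–Janse van Rensburg–Madras 2014 p. 5; Newman–Wu 1997). Sources: IlievJansevanrensburgMadras2014,
NewmanWu1997, DengBlote2005, Cardy1996, BarskyGrimmettNewman1991, GrimmettMarstrand1990, AizenmanGrimmett1991. -/
theorem stub_supercriticalPolyDomination : SupercriticalPolyDomination := by
  sorry

/-- **STUB 2 `rightUpperSemicontinuity`** (M, PROVABLE NOW): for `E ⊆ Sym2 ℤ³`, `v`, `p₀ < 1`, `c`: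
`(∀ p > p₀, c ≤ θ_{ℤ³∖E}(v,p)) → c ≤ θ_{ℤ³∖E}(v,p₀)`. Proof sketch: `θ ≤ θ_n = P_p(v ↔ ∂B(v,n))`
(`DCTQ.thetaN`; `percolatesAt v ⊆ armEvent v n` a.s.), `θ_n` is continuous in `p` (`DCTQ.continuous_thetaN`),
so `c ≤ θ_n(p₀)` letting `p ↓ p₀` inside `(p₀, 1] ≠ ∅`, then `DCTQ.le_theta_of_forall_le_real_armEvent`
(`n → ∞`, continuity of the measure from above); `LocallyFinite` for `(zdGraph 3).deleteEdges E` from the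
`zdGraph 3` instance. Sources: Grimmett1999 Lemma (8.9) p. 203; Russo1978. -/
theorem stub_rightUpperSemicontinuity : RightUpperSemicontinuity := by
  sorry

/-! ### Name-keyed aliases of the stub statements
`__Registered.stub_X` is statement `X` under the registered stub's short name, so that the native skeleton
audit (`#h21_check_skeleton`: hypotheses admissible iff registered obligations / declared stubs BY NAME)
accepts `GridWallPersistence_of : __Registered.stub_… → … → GridWallPersistence` (device of
`Cruxes/BGNOffTheFloor/Lines/birth.lean` and `Cruxes/PortalGridRung/Lines/birth.lean`; the `@[stub]` attribute
is gate-reserved). -/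
namespace __Registered

/-- Alias of `SupercriticalPolyDomination` keyed by the registered stub name. -/
abbrev stub_supercriticalPolyDomination : Prop := SupercriticalPolyDomination
/-- Alias of `RightUpperSemicontinuity` keyed by the registered stub name. -/
abbrev stub_rightUpperSemicontinuity : Prop := RightUpperSemicontinuity

end __Registered

/-! ## Proved plumbing -/

/-- `p_c(ℤ³) < 1` (Grimmett 1999 §1.4, in tree): the interval `(p_c, 1]` of STUB 1 is not empty and STUB 2
applies at `p₀ = p_c`. -/
theorem criticalProbI_three_lt_one : (criticalProbI 3 : ℝ) < 1 :=
  (Grimmett1999_criticalProb_pos_lt_one_holds 3 (by norm_num)).2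

/-- `θ ≥ 0` on `ℤ³` (a probability). -/
theorem theta_zd_nonneg (v : Site 3) (p : unitInterval) : 0 ≤ theta (zdGraph 3) v p :=
  measureReal_nonneg

/-- Monotonicity of `θ_{ℤ³}(0, ·)` in `p` (the monotone coupling, `theta_mono_holds`, in tree), in the
coerced form used below: `p_c < p ⇒ θ_{ℤ³}(0, p_c) ≤ θ_{ℤ³}(0, p)`. -/
theorem theta_zd_criticalProbI_le {p : unitInterval} (hp : (criticalProbI 3 : ℝ) < p) :
    theta (zdGraph 3) 0 (criticalProbI 3) ≤ theta (zdGraph 3) 0 p :=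
  theta_mono_holds (zdGraph 3) 0 (show criticalProbI 3 ≤ p from hp.le)

/-- STUB 1 transported to the critical value of the bulk density: for `p > p_c`,
`c · θ_{ℤ³}(0, p_c)^m ≤ c · θ_{ℤ³}(0, p)^m ≤ θ_{G_{Π_k}}(0, p)`. -/
theorem const_le_theta_gridGraph_of_dom {k m : ℕ} {c : ℝ} (hc : 0 < c)
    (hdom : ∀ p : unitInterval, (criticalProbI 3 : ℝ) < p →
      c * theta (zdGraph 3) 0 p ^ m ≤ theta (gridGraph k) 0 p)
    (p : unitInterval) (hp : (criticalProbI 3 : ℝ) < p) :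
    c * theta (zdGraph 3) 0 (criticalProbI 3) ^ m ≤ theta (gridGraph k) 0 p := by
  refine le_trans ?_ (hdom p hp)
  exact mul_le_mul_of_nonneg_left
    (pow_le_pow_left₀ (theta_zd_nonneg 0 _) (theta_zd_criticalProbI_le hp) m) hc.le

/-! ## The composition, by name -/

/-- **`GridWallPersistence_of`**: the two registered stubs imply the crux
`Summit.CriticalPhenomena.PercolationContinuityZ3.Theses.PercPortalLadder.GridWallPersistence`
(kernel-checked; no `sorry` outside the stubs) — transfer to the supercritical phase (STUB 1, made uniform in
`p` by the monotonicity of `θ_{ℤ³}`), then come down to `p_c` from the right (STUB 2 at `p₀ = p_c < 1`):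
the rivet vertex `0` percolates in `G_{Π_k}` at `p_c` with probability at least `c · θ_{ℤ³}(0, p_c)^m > 0`. -/
theorem GridWallPersistence_of (hdom : __Registered.stub_supercriticalPolyDomination)
    (husc : __Registered.stub_rightUpperSemicontinuity) :
    Summit.CriticalPhenomena.PercolationContinuityZ3.Theses.PercPortalLadder.GridWallPersistence := by
  refine gridWallPersistence_iff.2 fun hθ k hk => ⟨0, ?_⟩
  obtain ⟨m, c, hc, hcomp⟩ := hdom k hk
  -- the uniform supercritical lower bound `a = c · θ_{ℤ³}(0, p_c)^m > 0` …
  have ha : 0 < c * theta (zdGraph 3) 0 (criticalProbI 3) ^ m := mul_pos hc (pow_pos hθ m)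
  -- … persists at `p_c` by right upper semicontinuity of `θ_{G_{Π_k}}(0, ·)`
  have hpc : c * theta (zdGraph 3) 0 (criticalProbI 3) ^ m ≤ theta (gridGraph k) 0 (criticalProbI 3) :=
    husc (gridWall k) 0 (criticalProbI 3) criticalProbI_three_lt_one _
      (const_le_theta_gridGraph_of_dom hc hcomp)
  exact lt_of_lt_of_le ha hpc

/-- Wiring check: the registered stubs feed `GridWallPersistence_of` as stated. -/
example : Summit.CriticalPhenomena.PercolationContinuityZ3.Theses.PercPortalLadder.GridWallPersistence :=
  GridWallPersistence_of stub_supercriticalPolyDomination stub_rightUpperSemicontinuity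

/-! ## Special case `k = 1` (the definitions compute; the trivial bottom of STUB 1)
At spacing `1` every site of the plane is a rivet: the sealed wall is empty, `G_{Π_1} = ℤ³`, and STUB 1 holds
with `m = 1`, `c = 1`. (The crux at `k = 1` is likewise its own hypothesis, as the refuter crux-attack noted.) -/

/-- The sealed wall of spacing `1` is empty (`1 ∣ x₁`, `1 ∣ x₂` always). -/
theorem gridWall_one : gridWall 1 = ∅ := by
  ext e
  simp [gridWall]

/-- `G_{Π_1} = ℤ³`. -/
theorem gridGraph_one : gridGraph 1 = zdGraph 3 := by
  rw [gridGraph, gridWall_one, SimpleGraph.deleteEdges_empty]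

/-- STUB 1 at `k = 1`, proved: `1 · θ_{ℤ³}(0,p)^1 ≤ θ_{G_{Π_1}}(0,p)` for every `p` (in particular `p > p_c`). -/
theorem supercriticalPolyDomination_one :
    ∃ m : ℕ, ∃ c : ℝ, 0 < c ∧ ∀ p : unitInterval, (criticalProbI 3 : ℝ) < p →
      c * theta (zdGraph 3) 0 p ^ m ≤ theta (gridGraph 1) 0 p :=
  ⟨1, 1, one_pos, fun p _ => by rw [gridGraph_one, pow_one, one_mul]⟩

end Summit.CriticalPhenomena.PercolationContinuityZ3.Cruxes.GridWallPersistence.Birth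

end
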